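import Mathlib
import HarnessLib

/-!
# Eventual smallness of the master bound (helper toward `stub_poissonReduction`, line
`cofactor-root-discrepancy`, crux `SplitBlockJacobi`, stmt-Parity-11583)

With the parameter choices `κ = ε₀/8`, `T = ⌊x^κ⌋`, `I = T·(log₂⌊x²+2⌋ + 1)`, `L = ⌊η′x⌋`,
`κ(k+1) ≥ 4`, every term of the master inequality for `D^{bulk}` other than the smoothing loss
`219 k L ≤ 219 k η′ x` is `o(x)`; here we prove the elementary "eventually" statements
(`eventually_le_rpow`, `eventually_log_le_rpow`, `natLog_two_le`, …) and assemble them into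
`eventually_master_rhs_le`.
-/

noncomputable section

open Filter Finset

namespace Summit.Parity.BatemanHorn.Cruxes.SplitBlockJacobi.CofactorRootDiscrepancy.Poisson

/-! ### Elementary eventual facts along `x : ℕ → ∞` -/

/-- `C ≤ x^c` eventually (`c > 0`). -/
theorem eventually_le_rpow (c C : ℝ) (hc : 0 < c) : ∀ᶠ x : ℕ in atTop, C ≤ (x : ℝ) ^ c :=
  ((tendsto_rpow_atTop hc).comp tendsto_natCast_atTop_atTop).eventually_ge_atTop C

/-- `log x ≤ x^c` eventually (`c > 0`). -/
theorem eventually_log_le_rpow (c : ℝ) (hc : 0 < c) :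
    ∀ᶠ x : ℕ in atTop, Real.log x ≤ (x : ℝ) ^ c := by
  have h := ((isLittleO_log_rpow_atTop hc).comp_tendsto tendsto_natCast_atTop_atTop).bound
    zero_lt_one
  filter_upwards [h, eventually_ge_atTop 1] with x hx hx1
  have hl : 0 ≤ Real.log x := Real.log_nonneg (by exact_mod_cast hx1)
  have hr : 0 ≤ (x : ℝ) ^ c := by positivity
  simp only [Function.comp_apply, Real.norm_eq_abs, one_mul, abs_of_nonneg hl,
    abs_of_nonneg hr] at hx
  exact hx

/-- `C ≤ log x` eventually. -/
theorem eventually_le_log (C : ℝ) : ∀ᶠ x : ℕ in atTop, C ≤ Real.log x :=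
  (Real.tendsto_log_atTop.comp tendsto_natCast_atTop_atTop).eventually_ge_atTop C

/-- `log₂⌊x² + 2⌋ + 1 ≤ 7 log x` for `x ≥ 2`. -/
theorem natLog_two_le (x : ℕ) (hx : 2 ≤ x) :
    ((Nat.log 2 (x ^ 2 + 2) + 1 : ℕ) : ℝ) ≤ 7 * Real.log x := by
  set m := Nat.log 2 (x ^ 2 + 2) with hm
  have hpow : 2 ^ m ≤ x ^ 2 + 2 := Nat.pow_log_le_self 2 (by positivity)
  have hx2 : x ^ 2 + 2 ≤ 2 * x ^ 2 := by nlinarith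
  have hR : (2 : ℝ) ^ m ≤ 2 * (x : ℝ) ^ 2 := by exact_mod_cast hpow.trans hx2
  have hxR : (0 : ℝ) < x := by exact_mod_cast (show 0 < x by omega)
  have hlog := Real.log_le_log (by positivity) hR
  rw [Real.log_pow, Real.log_mul (by norm_num) (by positivity), Real.log_pow] at hlog
  have hl2 : (0.6931471803 : ℝ) < Real.log 2 := Real.log_two_gt_d9
  have hlx : Real.log 2 ≤ Real.log x := Real.log_le_log (by norm_num) (by exact_mod_cast hx)
  push_cast
  -- `m log 2 ≤ log 2 + 2 log x` gives `m ≤ 1 + 2 log x / log 2 ≤ 1 + 3 log x`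
  have hm1 : (m : ℝ) ≤ 1 + 3 * Real.log x := by
    have h1 : (m : ℝ) * Real.log 2 ≤ Real.log 2 + 2 * Real.log x := by
      have := hlog; push_cast at this; linarith
    nlinarith
  nlinarith

/-- `y/2 ≤ ⌊y⌋₊` for `y ≥ 2`. -/
theorem half_le_floor {y : ℝ} (hy : 2 ≤ y) : y / 2 ≤ (⌊y⌋₊ : ℝ) := by
  have := Nat.lt_floor_add_one y
  linarith

/-! ### The master right-hand side is eventually `≤ ε′ x` -/

set_option maxHeartbeats 400000 in
/-- **Eventual smallness of the master bound.** With `κ = ε₀/8`, `T = ⌊x^κ⌋`,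
`I = T (log₂⌊x²+2⌋ + 1)`, `L = ⌊η′ x⌋`, `219 k η′ ≤ ε′/4` and `κ (k+1) ≥ 4`, the right-hand side of
`abs_Dbulk_le_master` is eventually at most `ε′ x`. -/
theorem eventually_master_rhs_le (μ ε₀ C₁ ε' η' : ℝ) (k : ℕ) (hμ0 : 0 < μ) (hμ1 : μ < 1)
    (hε₀ : 0 < ε₀) (hε₀1 : ε₀ ≤ 1) (hC₁ : 0 ≤ C₁) (hε' : 0 < ε') (hη' : 0 < η')
    (hkη : 219 * k * η' ≤ ε' / 4) (hk : 4 ≤ ε₀ / 8 * (k + 1)) :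
    ∀ᶠ x : ℕ in atTop,
      219 * ((k * ⌊η' * x⌋₊ : ℕ) : ℝ) +
        ((⌊(x : ℝ) ^ (ε₀ / 8)⌋₊ * (Nat.log 2 (x ^ 2 + 2) + 1) : ℕ) : ℝ) ^ 2 *
          (48672 * (x : ℝ) ^ (1 - ε₀ + 3 * (ε₀ / 8)) +
            4 * (x : ℝ) ^ (2 - μ) * ((x : ℝ) ^ (1 - ε₀ / 8)) ^ (k + 1) /
              ((⌊η' * x⌋₊ : ℕ) : ℝ) ^ k) +
        (C₁ * (Real.sqrt (2 / ((⌊(x : ℝ) ^ (ε₀ / 8)⌋₊ : ℕ) : ℝ)) * x + (x : ℝ) ^ μ + 1) +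
          (16 * x * (1 + Real.log x) / ((⌊(x : ℝ) ^ (ε₀ / 8)⌋₊ : ℕ) : ℝ) + 8 * (x : ℝ) ^ μ)) ≤
      ε' * x := by
  set κ : ℝ := ε₀ / 8 with hκ
  have hκ0 : 0 < κ := by positivity
  have hκ1 : 3 * κ ≤ 1 := by rw [hκ]; linarith
  -- thresholds
  have e1 := eventually_ge_atTop 2
  have e2 := eventually_le_rpow κ 4 hκ0
  have e3 := eventually_log_le_rpow (κ / 2) (by positivity)
  have e4 := eventually_le_log 1
  have e5 := eventually_ge_atTop ⌈2 / η'⌉₊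
  have e6 := eventually_le_rpow (2 * κ) (10 * (49 * 48672) / ε') (by positivity)
  have e7 := eventually_ge_atTop ⌈1960 * (2 / η') ^ k / ε'⌉₊
  have e8 := eventually_le_rpow κ (2 * (2 * (10 * (C₁ + 1) / ε') ^ 2)) hκ0
  have e9 := eventually_le_rpow (1 - μ) (10 * (C₁ + 8) / ε') (by linarith)
  have e10 := eventually_ge_atTop ⌈10 * C₁ / ε'⌉₊
  have e11 := eventually_le_rpow (κ / 2) (640 / ε') (by positivity)
  filter_upwards [e1, e2, e3, e4, e5, e6, e7, e8, e9, e10, e11] with x hx2 hxκ hlog hlog1 hxη hx6 hx7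
    hx8 hx9 hx10 hx11
  -- basic quantities
  have hxR : (0 : ℝ) < x := by exact_mod_cast (show 0 < x by omega)
  have hxR1 : (1 : ℝ) ≤ x := by exact_mod_cast (show 1 ≤ x by omega)
  set T : ℕ := ⌊(x : ℝ) ^ κ⌋₊ with hT
  set L : ℕ := ⌊η' * x⌋₊ with hL
  set I : ℕ := T * (Nat.log 2 (x ^ 2 + 2) + 1) with hI
  have hTle : (T : ℝ) ≤ (x : ℝ) ^ κ := Nat.floor_le (by positivity)
  have hTge : (x : ℝ) ^ κ / 2 ≤ T := half_le_floor (by linarith)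
  have hT0 : (0 : ℝ) < T := by linarith
  have hηx : 2 ≤ η' * x := by
    have : (⌈2 / η'⌉₊ : ℝ) ≤ x := by exact_mod_cast hxη
    have h2 : 2 / η' ≤ x := (Nat.le_ceil _).trans this
    rwa [div_le_iff₀ hη', mul_comm] at h2
  have hLle : (L : ℝ) ≤ η' * x := Nat.floor_le (by positivity)
  have hLge : η' * x / 2 ≤ L := half_le_floor hηx
  have hL0 : (0 : ℝ) < L := by linarith
  -- `I ≤ 7 x^κ log x`, `I² ≤ 49 x^{3κ}`
  have hIle : (I : ℝ) ≤ 7 * (x : ℝ) ^ κ * Real.log x := by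
    rw [hI]; push_cast
    have h := natLog_two_le x hx2
    push_cast at h
    calc (T : ℝ) * ((Nat.log 2 (x ^ 2 + 2) : ℝ) + 1) ≤ (x : ℝ) ^ κ * (7 * Real.log x) :=
          mul_le_mul hTle h (by positivity) (by positivity)
      _ = _ := by ring
  have hκκ : (x : ℝ) ^ (κ / 2) * (x : ℝ) ^ (κ / 2) = (x : ℝ) ^ κ := by
    rw [← Real.rpow_add hxR]; ring_nf
  have hlog2 : Real.log x ^ 2 ≤ (x : ℝ) ^ κ := by
    rw [sq, ← hκκ]; exact mul_le_mul hlog hlog (by linarith) (by positivity)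
  have hI2 : (I : ℝ) ^ 2 ≤ 49 * (x : ℝ) ^ (3 * κ) := by
    have h3 : (x : ℝ) ^ (3 * κ) = (x : ℝ) ^ κ * (x : ℝ) ^ κ * (x : ℝ) ^ κ := by
      rw [← Real.rpow_add hxR, ← Real.rpow_add hxR]; ring_nf
    calc (I : ℝ) ^ 2 ≤ (7 * (x : ℝ) ^ κ * Real.log x) ^ 2 := pow_le_pow_left₀ (by positivity) hIle 2
      _ = 49 * ((x : ℝ) ^ κ * (x : ℝ) ^ κ) * Real.log x ^ 2 := by ring
      _ ≤ 49 * ((x : ℝ) ^ κ * (x : ℝ) ^ κ) * (x : ℝ) ^ κ :=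
          mul_le_mul_of_nonneg_left hlog2 (by positivity)
      _ = 49 * (x : ℝ) ^ (3 * κ) := by rw [h3]; ring
  have hI2x : (I : ℝ) ^ 2 ≤ 49 * x := by
    refine hI2.trans (mul_le_mul_of_nonneg_left ?_ (by norm_num))
    conv_rhs => rw [← Real.rpow_one (x : ℝ)]
    exact Real.rpow_le_rpow_of_exponent_le hxR1 hκ1
  -- ### term 0: the smoothing loss
  have h0 : 219 * ((k * L : ℕ) : ℝ) ≤ ε' / 4 * x := by
    push_cast
    calc 219 * ((k : ℝ) * L) ≤ 219 * ((k : ℝ) * (η' * x)) := by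
          refine mul_le_mul_of_nonneg_left (mul_le_mul_of_nonneg_left hLle (Nat.cast_nonneg _)) ?_
          norm_num
      _ = (219 * k * η') * x := by ring
      _ ≤ ε' / 4 * x := mul_le_mul_of_nonneg_right hkη hxR.le
  -- ### term 1: `I² · 48672 x^{1-ε₀+3κ}`
  have h1 : (I : ℝ) ^ 2 * (48672 * (x : ℝ) ^ (1 - ε₀ + 3 * (ε₀ / 8))) ≤ ε' / 10 * x := by
    have hexp : (x : ℝ) ^ (3 * κ) * (x : ℝ) ^ (1 - ε₀ + 3 * (ε₀ / 8)) = (x : ℝ) ^ (1 - 2 * κ) := by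
      rw [← Real.rpow_add hxR, hκ]; ring_nf
    have hx1 : (x : ℝ) ^ (2 * κ) * (x : ℝ) ^ (1 - 2 * κ) = x := by
      rw [← Real.rpow_add hxR]; ring_nf; exact Real.rpow_one _
    calc (I : ℝ) ^ 2 * (48672 * (x : ℝ) ^ (1 - ε₀ + 3 * (ε₀ / 8)))
        ≤ 49 * (x : ℝ) ^ (3 * κ) * (48672 * (x : ℝ) ^ (1 - ε₀ + 3 * (ε₀ / 8))) :=
          mul_le_mul_of_nonneg_right hI2 (by positivity)
      _ = (49 * 48672) * (x : ℝ) ^ (1 - 2 * κ) := by rw [← hexp]; ring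
      _ ≤ (ε' / 10 * (x : ℝ) ^ (2 * κ)) * (x : ℝ) ^ (1 - 2 * κ) := by
          refine mul_le_mul_of_nonneg_right ?_ (by positivity)
          rw [div_le_iff₀ hε'] at hx6
          linarith
      _ = ε' / 10 * x := by rw [mul_assoc, hx1]
  -- ### term 2: `I² · 4 x^{2-μ} (x^{1-κ})^{k+1} / L^k`
  have h2 : (I : ℝ) ^ 2 * (4 * (x : ℝ) ^ (2 - μ) * ((x : ℝ) ^ (1 - ε₀ / 8)) ^ (k + 1) / (L : ℝ) ^ k) ≤
      ε' / 10 * x := by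
    -- `(x^{1-κ})^{k+1} ≤ x^{k-3}`
    have hpow : ((x : ℝ) ^ (1 - ε₀ / 8)) ^ (k + 1) ≤ (x : ℝ) ^ ((k : ℝ) - 3) := by
      rw [← Real.rpow_mul_natCast hxR.le]
      refine Real.rpow_le_rpow_of_exponent_le hxR1 ?_
      push_cast
      rw [hκ] at hk
      linarith
    have hxμ2 : (x : ℝ) ^ (2 - μ) ≤ (x : ℝ) ^ (2 : ℝ) :=
      Real.rpow_le_rpow_of_exponent_le hxR1 (by linarith)
    have hLk : (η' * x / 2) ^ k ≤ (L : ℝ) ^ k := pow_le_pow_left₀ (by positivity) hLge k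
    have hkey : (x : ℝ) ^ (2 : ℝ) * (x : ℝ) ^ ((k : ℝ) - 3) = (x : ℝ) ^ k / x := by
      rw [← Real.rpow_add hxR, ← Real.rpow_natCast,
        show (2 : ℝ) + ((k : ℝ) - 3) = (k : ℝ) - 1 by ring, Real.rpow_sub_one hxR.ne']
    have hstep : 4 * (x : ℝ) ^ (2 - μ) * ((x : ℝ) ^ (1 - ε₀ / 8)) ^ (k + 1) / (L : ℝ) ^ k ≤
        4 * ((x : ℝ) ^ k / x) / (η' * x / 2) ^ k := by
      calc 4 * (x : ℝ) ^ (2 - μ) * ((x : ℝ) ^ (1 - ε₀ / 8)) ^ (k + 1) / (L : ℝ) ^ k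
          ≤ 4 * (x : ℝ) ^ (2 : ℝ) * (x : ℝ) ^ ((k : ℝ) - 3) / (η' * x / 2) ^ k := by
            refine div_le_div₀ (by positivity) ?_ (by positivity) hLk
            exact mul_le_mul (mul_le_mul_of_nonneg_left hxμ2 (by norm_num)) hpow (by positivity)
              (by positivity)
        _ = 4 * ((x : ℝ) ^ k / x) / (η' * x / 2) ^ k := by rw [mul_assoc, hkey]
    have hsimp : 4 * ((x : ℝ) ^ k / x) / (η' * x / 2) ^ k = 4 * (2 / η') ^ k / x := by
      rw [div_pow, mul_pow, div_pow]
      field_simp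
    rw [hsimp] at hstep
    have h7 : 1960 * (2 / η') ^ k / ε' ≤ x :=
      (Nat.le_ceil _).trans (by exact_mod_cast hx7)
    rw [div_le_iff₀ hε'] at h7
    calc (I : ℝ) ^ 2 * (4 * (x : ℝ) ^ (2 - μ) * ((x : ℝ) ^ (1 - ε₀ / 8)) ^ (k + 1) / (L : ℝ) ^ k)
        ≤ (49 * x) * (4 * (2 / η') ^ k / x) :=
          mul_le_mul hI2x hstep (by positivity) (by positivity)
      _ = 196 * (2 / η') ^ k := by field_simp; norm_num
      _ ≤ ε' / 10 * x := by linarith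
  -- ### term 3: `C₁ √(2/T) x`
  have h3 : C₁ * (Real.sqrt (2 / (T : ℝ)) * x) ≤ ε' / 10 * x := by
    have hC1 : 0 < C₁ + 1 := by linarith
    have hsq : Real.sqrt (2 / (T : ℝ)) ≤ ε' / (10 * (C₁ + 1)) := by
      refine Real.sqrt_le_iff.mpr ⟨by positivity, ?_⟩
      rw [div_le_iff₀ hT0]
      have hT' : 2 * (10 * (C₁ + 1) / ε') ^ 2 ≤ T := by linarith
      have : (2 : ℝ) = (ε' / (10 * (C₁ + 1))) ^ 2 * (2 * (10 * (C₁ + 1) / ε') ^ 2) := by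
        field_simp
      rw [this]
      exact mul_le_mul_of_nonneg_left hT' (by positivity)
    calc C₁ * (Real.sqrt (2 / (T : ℝ)) * x) ≤ (C₁ + 1) * (ε' / (10 * (C₁ + 1)) * x) := by
          refine mul_le_mul (by linarith) (mul_le_mul_of_nonneg_right hsq hxR.le) (by positivity)
            hC1.le
      _ = ε' / 10 * x := by field_simp
  -- ### term 4: the `x^μ` terms and the constant
  have hxμ : (x : ℝ) ^ μ * (x : ℝ) ^ (1 - μ) = x := by
    rw [← Real.rpow_add hxR]; ring_nf; exact Real.rpow_one _
  have h4 : C₁ * (x : ℝ) ^ μ + 8 * (x : ℝ) ^ μ ≤ ε' / 10 * x := by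
    rw [div_le_iff₀ hε'] at hx9
    calc C₁ * (x : ℝ) ^ μ + 8 * (x : ℝ) ^ μ = (C₁ + 8) * (x : ℝ) ^ μ := by ring
      _ ≤ (ε' / 10 * (x : ℝ) ^ (1 - μ)) * (x : ℝ) ^ μ := by
          refine mul_le_mul_of_nonneg_right ?_ (by positivity)
          linarith
      _ = ε' / 10 * x := by rw [mul_assoc, mul_comm ((x : ℝ) ^ (1 - μ)), hxμ]
  have h5 : C₁ ≤ ε' / 10 * x := by
    have : 10 * C₁ / ε' ≤ x := (Nat.le_ceil _).trans (by exact_mod_cast hx10)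
    rw [div_le_iff₀ hε'] at this
    linarith
  -- ### term 5: `16 x (1 + log x) / T`
  have h6 : 16 * x * (1 + Real.log x) / T ≤ ε' / 10 * x := by
    rw [div_le_iff₀ hT0]
    have hl : 1 + Real.log x ≤ 2 * (x : ℝ) ^ (κ / 2) := by linarith
    rw [div_le_iff₀ hε'] at hx11
    -- `16 x (1 + log x) ≤ 32 x · x^{κ/2}` and `ε'/10 · x · T ≥ ε'/10 · x · x^κ / 2`
    have hA : 16 * (x : ℝ) * (1 + Real.log x) ≤ 32 * x * (x : ℝ) ^ (κ / 2) := by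
      calc 16 * (x : ℝ) * (1 + Real.log x) ≤ 16 * (x : ℝ) * (2 * (x : ℝ) ^ (κ / 2)) :=
            mul_le_mul_of_nonneg_left hl (by positivity)
        _ = _ := by ring
    have hB : ε' / 10 * x * ((x : ℝ) ^ κ / 2) ≤ ε' / 10 * x * T :=
      mul_le_mul_of_nonneg_left hTge (by positivity)
    have hy0 : 0 ≤ (x : ℝ) ^ (κ / 2) := Real.rpow_nonneg hxR.le _
    have h32 : 32 ≤ ε' / 20 * (x : ℝ) ^ (κ / 2) := by linarith
    have hC : 32 * (x : ℝ) * (x : ℝ) ^ (κ / 2) ≤ ε' / 10 * x * ((x : ℝ) ^ κ / 2) := by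
      rw [← hκκ]
      calc 32 * (x : ℝ) * (x : ℝ) ^ (κ / 2) = x * (32 * (x : ℝ) ^ (κ / 2)) := by ring
        _ ≤ x * ((ε' / 20 * (x : ℝ) ^ (κ / 2)) * (x : ℝ) ^ (κ / 2)) :=
            mul_le_mul_of_nonneg_left (mul_le_mul_of_nonneg_right h32 hy0) hxR.le
        _ = _ := by ring
    linarith
  -- ### assembly
  have hsplit : C₁ * (Real.sqrt (2 / (T : ℝ)) * x + (x : ℝ) ^ μ + 1) +
      (16 * x * (1 + Real.log x) / T + 8 * (x : ℝ) ^ μ) =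
      C₁ * (Real.sqrt (2 / (T : ℝ)) * x) + (C₁ * (x : ℝ) ^ μ + 8 * (x : ℝ) ^ μ) + C₁ +
        16 * x * (1 + Real.log x) / T := by ring
  rw [mul_add, hsplit]
  nlinarith [h0, h1, h2, h3, h4, h5, h6]

end Summit.Parity.BatemanHorn.Cruxes.SplitBlockJacobi.CofactorRootDiscrepancy.Poisson

namespace Summit.Parity.BatemanHorn.Cruxes.SplitBlockJacobi.CofactorRootDiscrepancy

/-- **Registered stub form** of `Poisson.eventually_master_rhs_le`: the identical statement, declared in the crux
namespace under the name registered on stmt-Parity-11583 (`ledger workitem stub-add`). -/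
theorem eventually_master_rhs_le :
    ∀ (μ ε₀ C₁ ε' η' : ℝ) (k : ℕ) (hμ0 : 0 < μ) (hμ1 : μ < 1) (hε₀ : 0 < ε₀) (hε₀1 : ε₀ ≤ 1) (hC₁ : 0 ≤ C₁) (hε' : 0 < ε') (hη' : 0 < η') (hkη : 219 * k * η' ≤ ε' / 4) (hk : 4 ≤ ε₀ / 8 * (k + 1)), ∀ᶠ x : ℕ in Filter.atTop, 219 * ((k * ⌊η' * x⌋₊ : ℕ) : ℝ) + ((⌊(x : ℝ) ^ (ε₀ / 8)⌋₊ * (Nat.log 2 (x ^ 2 + 2) + 1) : ℕ) : ℝ) ^ 2 * (48672 * (x : ℝ) ^ (1 - ε₀ + 3 * (ε₀ / 8)) + 4 * (x : ℝ) ^ (2 - μ) * ((x : ℝ) ^ (1 - ε₀ / 8)) ^ (k + 1) / ((⌊η' * x⌋₊ : ℕ) : ℝ) ^ k) + (C₁ * (Real.sqrt (2 / ((⌊(x : ℝ) ^ (ε₀ / 8)⌋₊ : ℕ) : ℝ)) * x + (x : ℝ) ^ μ + 1) + (16 * x * (1 + Real.log x) / ((⌊(x : ℝ) ^ (ε₀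 / 8)⌋₊ : ℕ) : ℝ) + 8 * (x : ℝ) ^ μ)) ≤ ε' * x :=
  @Poisson.eventually_master_rhs_le

end Summit.Parity.BatemanHorn.Cruxes.SplitBlockJacobi.CofactorRootDiscrepancy

end
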